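import Literature.NumberTheory.PAdicHodge.TateAlmostEtaleSylow
import Literature.NumberTheory.PAdicHodge.TateSenConditionOfAlmostEtale
import Mathlib.FieldTheory.Normal.Closure

/-!
# The Tate–Sen axiom (TS1) from the tame package — assembly of the Kummer route (dévissage D′3)

The cite-only Tate–Sen axiom `tate1967_TS1_completedAlgClosure` was reduced BY NAME to Tate's
Prop. 9 in finite-base trace form (`TS1_of_almostEtale_fin`); Prop. 9 for finite Galois `L/K_∞` and
any intermediate `L₂` is `prop9_galois_of_tame` (Sylow reduction, granted the tame package (C)). Here:
* `prop9_pushdown_of_tame`: for `K_∞ ⊆ L₂ ⊆ L₁ ⊆ L` with `L/K_∞` finite Galois, a `z ∈ L₁` with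
  `Tr_{L₁/L₂}(z) = 1` and `‖z‖ ≤ ‖p‖⁻¹` (push down by `Tr_{L/L₁}`, which does not increase norms);
* `h9_fin_of_tame`: the finite-base trace form of Prop. 9 for arbitrary finite `L₂ ⊆ L₁` over `K_∞`
  (pass to the Galois closure of `L₁` over `K_∞` inside `F̄`);
* `TS1_of_tame`, `tate1967_TS1_of_tame`: **(TS1) for every `p`-adic field `F`, BY NAME, from the
  single remaining hypothesis (C): finite extensions of `K_∞ = F(μ_{p^∞})·ℚ_p^{base}` inside `F̄` of
  degree prime to `p` are almost-perfectoid.**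

[cite: Tate1967, §3.2 Prop. 9, Prop. 10] [cite: BergerColmez2008, Prop. 4.1.1]
-/

noncomputable section

open Polynomial IntermediateField Module ValuativeRel Field

namespace Literature.NumberTheory.PAdicHodge

namespace TateAlmostEtale

open Literature.NumberTheory.GaloisRepresentations
open Literature.NumberTheory.GaloisRepresentations.IsNonarchimedeanLocalField

variable {F : Type} [Field F] [ValuativeRel F] [TopologicalSpace F] [IsNonarchimedeanLocalField F]
  [CharZero F] {p : ℕ} [Fact p.Prime] (hp : valuation F p < 1)

set_option synthInstance.maxHeartbeats 200000 in
set_option maxHeartbeats 1600000 in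
/-- **Prop. 9 pushed down to an intermediate field.** For `K_∞ ⊆ L₂ ⊆ L₁ ⊆ L ⊆ F̄` with `L/K_∞`
finite Galois (and the tame package (C)): `z ∈ L₁` with `Tr_{L₁/L₂}(z) = 1`, `‖z‖ ≤ ‖p‖⁻¹`
(`z = Tr_{L/L₁}(y)` for the `y` of `prop9_galois_of_tame`, `‖Tr(y)‖ ≤ ‖y‖` by `norm_trace_le`).
[cite: Tate1967, §3.2 Prop. 9] -/
theorem prop9_pushdown_of_tame
    (hC : ∀ (T : IntermediateField (TateTrace.Kinf hp) (NormedAlgClosure F)),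
      FiniteDimensional (TateTrace.Kinf hp) T → ¬ p ∣ finrank (TateTrace.Kinf hp) T →
      ∃ s : ℝ, 0 < s ∧ (∀ x ∈ T, x ≠ 0 → ∃ c ∈ T, ‖c‖ ^ p = ‖x‖) ∧
        (∀ u ∈ T, ‖u‖ ≤ 1 → ∃ w ∈ T, ‖u - w ^ p‖ ≤ ‖(p : NormedAlgClosure F)‖ ^ s))
    (L : IntermediateField (TateTrace.Kinf hp) (NormedAlgClosure F))
    [FiniteDimensional (TateTrace.Kinf hp) L] [IsGalois (TateTrace.Kinf hp) L]
    (L₂ : IntermediateField (TateTrace.Kinf hp) L) (L₁ : IntermediateField L₂ L) :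
    ∃ z : L₁, Algebra.trace L₂ L₁ z = 1 ∧
      ‖(((z : L₁) : L) : NormedAlgClosure F)‖ ≤ ‖(p : NormedAlgClosure F)‖⁻¹ := by
  classical
  obtain ⟨y, hytr, hyn⟩ := prop9_galois_of_tame hp hC L L₂ one_pos
  rw [Real.rpow_neg_one] at hyn
  -- the `E`-world copy of `L₁ ⊆ L`: base `M₁` over `K₀`, top `Lm`
  set M₁ : IntermediateField (PadicBase F p hp) (NormedAlgClosure F) :=
    (IntermediateField.lift (L₁.restrictScalars (TateTrace.Kinf hp))).restrictScalars
      (PadicBase F p hp) with hM₁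
  have hmemM₁ : ∀ x : NormedAlgClosure F, x ∈ M₁ ↔
      x ∈ IntermediateField.lift (L₁.restrictScalars (TateTrace.Kinf hp)) := fun x =>
    IntermediateField.mem_restrictScalars (PadicBase F p hp)
  have hM₁L : M₁ ≤ L.restrictScalars (PadicBase F p hp) := by
    intro x hx
    rw [IntermediateField.mem_restrictScalars]
    exact IntermediateField.lift_le _ ((hmemM₁ x).mp hx)
  set Lm : IntermediateField M₁ (NormedAlgClosure F) := IntermediateField.extendScalars hM₁L with hLm
  have hmemLm : ∀ x : NormedAlgClosure F, x ∈ Lm ↔ x ∈ L := fun x => Iff.rfl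
  have hback : ∀ m : M₁, ∃ hm : (m : NormedAlgClosure F) ∈ L, (⟨m, hm⟩ : L) ∈ L₁ := by
    intro m
    have h := (hmemM₁ _).mp m.2
    have hmL : (m : NormedAlgClosure F) ∈ L := IntermediateField.lift_le _ h
    refine ⟨hmL, ?_⟩
    have := (IntermediateField.mem_lift (⟨(m : NormedAlgClosure F), hmL⟩ : L)).mp h
    exact (IntermediateField.mem_restrictScalars (TateTrace.Kinf hp)).mp this
  let f : L₁ ≃+* M₁ :=
    { toFun := fun z => ⟨((z : L) : NormedAlgClosure F), (hmemM₁ _).mpr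
        ((IntermediateField.mem_lift (z : L)).mpr
          ((IntermediateField.mem_restrictScalars (TateTrace.Kinf hp)).mpr z.2))⟩
      invFun := fun m => ⟨⟨(m : NormedAlgClosure F), (hback m).1⟩, (hback m).2⟩
      left_inv := fun z => rfl
      right_inv := fun m => rfl
      map_mul' := fun x y => rfl
      map_add' := fun x y => rfl }
  let g : L ≃+* Lm :=
    { toFun := fun y => ⟨(y : NormedAlgClosure F), (hmemLm _).mpr y.2⟩
      invFun := fun y => ⟨(y : NormedAlgClosure F), (hmemLm _).mp y.2⟩
      left_inv := fun y => rfl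
      right_inv := fun y => rfl
      map_mul' := fun x y => rfl
      map_add' := fun x y => rfl }
  have hcomp : (algebraMap M₁ Lm).comp f.toRingHom = g.toRingHom.comp (algebraMap L₁ L) := by
    ext x; rfl
  haveI : FiniteDimensional M₁ Lm := Module.Finite.of_equiv_equiv f g hcomp
  refine ⟨Algebra.trace L₁ L y, ?_, ?_⟩
  · rw [Algebra.trace_trace]; exact hytr
  · have h := Algebra.trace_eq_of_equiv_equiv f g hcomp y
    have hle := norm_trace_le hp M₁ Lm (g y)
    have hE : (((Algebra.trace L₁ L y : L₁) : L) : NormedAlgClosure F) =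
        ((Algebra.trace M₁ Lm (g y) : M₁) : NormedAlgClosure F) := by
      rw [h]; rfl
    rw [hE]
    exact hle.trans hyn

set_option synthInstance.maxHeartbeats 200000 in
set_option maxHeartbeats 1600000 in
/-- **Tate's Prop. 9 in the finite-base trace form (the hypothesis of `TS1_of_almostEtale_fin`),
granted the tame package (C).** For `K_∞ ⊆ L₂ ⊆ L₁ ⊆ F̄` with `L₂/K_∞` and `L₁/L₂` finite there is
`y ∈ L₁` with `Tr_{L₁/L₂}(y) = 1` and `‖y‖ ≤ ‖p‖⁻¹` (pass to the Galois closure of `L₁/K_∞` in `F̄`,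
Mathlib `normalClosure`, and use `prop9_pushdown_of_tame`). [cite: Tate1967, §3.2 Prop. 9] -/
theorem h9_fin_of_tame
    (hC : ∀ (T : IntermediateField (TateTrace.Kinf hp) (NormedAlgClosure F)),
      FiniteDimensional (TateTrace.Kinf hp) T → ¬ p ∣ finrank (TateTrace.Kinf hp) T →
      ∃ s : ℝ, 0 < s ∧ (∀ x ∈ T, x ≠ 0 → ∃ c ∈ T, ‖c‖ ^ p = ‖x‖) ∧
        (∀ u ∈ T, ‖u‖ ≤ 1 → ∃ w ∈ T, ‖u - w ^ p‖ ≤ ‖(p : NormedAlgClosure F)‖ ^ s))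
    (L₂ : IntermediateField (PadicBase F p hp) (NormedAlgClosure F))
    (hK : TateTrace.Kinf hp ≤ L₂) (hfin : FiniteDimensional (TateTrace.Kinf hp) (extendScalars hK))
    (L₁ : IntermediateField L₂ (NormedAlgClosure F)) (hfin₁ : FiniteDimensional L₂ L₁) :
    ∃ y : L₁, Algebra.trace L₂ L₁ y = 1 ∧
      ‖(y : NormedAlgClosure F)‖ ≤ ‖(p : NormedAlgClosure F)‖⁻¹ := by
  classical
  haveI := hfin
  haveI := hfin₁
  -- `L₂ ⊆ L₁` as intermediate fields over `K_∞`
  set L₂' : IntermediateField (TateTrace.Kinf hp) (NormedAlgClosure F) := extendScalars hK with hL₂'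
  have hL₂L₁ : L₂ ≤ L₁.restrictScalars (PadicBase F p hp) := by
    intro x hx
    rw [IntermediateField.mem_restrictScalars]
    exact L₁.algebraMap_mem ⟨x, hx⟩
  set L₁' : IntermediateField (TateTrace.Kinf hp) (NormedAlgClosure F) :=
    extendScalars (hK.trans hL₂L₁) with hL₁'
  have hmemL₁' : ∀ x : NormedAlgClosure F, x ∈ L₁' ↔ x ∈ L₁ := fun x => Iff.rfl
  have hmemL₂' : ∀ x : NormedAlgClosure F, x ∈ L₂' ↔ x ∈ L₂ := fun x => Iff.rfl
  have hle' : L₂' ≤ L₁' := fun x hx => (hmemL₁' x).mpr ((IntermediateField.mem_restrictScalars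
    (PadicBase F p hp)).mp (hL₂L₁ ((hmemL₂' x).mp hx)))
  -- finiteness of `L₁'` over `K_∞`
  set X₁ : IntermediateField L₂' (NormedAlgClosure F) := extendScalars hle' with hX₁
  have hmemX₁ : ∀ x : NormedAlgClosure F, x ∈ X₁ ↔ x ∈ L₁ := fun x => Iff.rfl
  let e₁ : L₂ ≃+* L₂' :=
    { toFun := fun x => ⟨(x : NormedAlgClosure F), (hmemL₂' _).mpr x.2⟩
      invFun := fun x => ⟨(x : NormedAlgClosure F), (hmemL₂' _).mp x.2⟩
      left_inv := fun x => rfl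
      right_inv := fun x => rfl
      map_mul' := fun x y => rfl
      map_add' := fun x y => rfl }
  let e₂ : L₁ ≃+* X₁ :=
    { toFun := fun x => ⟨(x : NormedAlgClosure F), (hmemX₁ _).mpr x.2⟩
      invFun := fun x => ⟨(x : NormedAlgClosure F), (hmemX₁ _).mp x.2⟩
      left_inv := fun x => rfl
      right_inv := fun x => rfl
      map_mul' := fun x y => rfl
      map_add' := fun x y => rfl }
  have hcomp₁₂ : (algebraMap L₂' X₁).comp e₁.toRingHom = e₂.toRingHom.comp (algebraMap L₂ L₁) := by
    ext x; rfl
  haveI : Module.Finite L₂' X₁ := Module.Finite.of_equiv_equiv e₁ e₂ hcomp₁₂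
  haveI hX₁fin : FiniteDimensional (TateTrace.Kinf hp) X₁ := Module.Finite.trans L₂' X₁
  let e₃ : X₁ ≃+* L₁' :=
    { toFun := fun x => ⟨(x : NormedAlgClosure F), (hmemL₁' _).mpr ((hmemX₁ _).mp x.2)⟩
      invFun := fun x => ⟨(x : NormedAlgClosure F), (hmemX₁ _).mpr ((hmemL₁' _).mp x.2)⟩
      left_inv := fun x => rfl
      right_inv := fun x => rfl
      map_mul' := fun x y => rfl
      map_add' := fun x y => rfl }
  have hcomp₃ : (algebraMap (TateTrace.Kinf hp) L₁').comp
      (RingEquiv.refl (TateTrace.Kinf hp)).toRingHom =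
      e₃.toRingHom.comp (algebraMap (TateTrace.Kinf hp) X₁) := by
    ext x; rfl
  haveI hL₁'fin : FiniteDimensional (TateTrace.Kinf hp) L₁' :=
    Module.Finite.of_equiv_equiv (RingEquiv.refl (TateTrace.Kinf hp)) e₃ hcomp₃
  -- the Galois closure `N` of `L₁'` over `K_∞` inside `F̄`
  haveI : Normal (TateTrace.Kinf hp) (NormedAlgClosure F) :=
    Normal.tower_top_of_normal (PadicBase F p hp) (TateTrace.Kinf hp) (NormedAlgClosure F)
  set N : IntermediateField (TateTrace.Kinf hp) (NormedAlgClosure F) :=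
    normalClosure (TateTrace.Kinf hp) L₁' (NormedAlgClosure F) with hN
  haveI : CharZero (TateTrace.Kinf hp) :=
    charZero_of_injective_algebraMap (algebraMap (PadicBase F p hp) (TateTrace.Kinf hp)).injective
  haveI : Algebra.IsSeparable (TateTrace.Kinf hp) N := Algebra.IsAlgebraic.isSeparable_of_perfectField
  haveI : IsGalois (TateTrace.Kinf hp) N := isGalois_iff.mpr ⟨inferInstance, inferInstance⟩
  have hL₁N : L₁' ≤ N := IntermediateField.le_normalClosure L₁'
  have hL₂N : L₂' ≤ N := hle'.trans hL₁N
  -- `L₂ ⊆ L₁` inside `N`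
  set L₂N : IntermediateField (TateTrace.Kinf hp) N := IntermediateField.restrict hL₂N with hL₂N'
  set L₁N' : IntermediateField (TateTrace.Kinf hp) N := IntermediateField.restrict hL₁N with hL₁N''
  have hmemL₂N : ∀ x : N, x ∈ L₂N ↔ (x : NormedAlgClosure F) ∈ L₂ := fun x => by
    rw [hL₂N', IntermediateField.mem_restrict]; exact hmemL₂' x
  have hmemL₁N' : ∀ x : N, x ∈ L₁N' ↔ (x : NormedAlgClosure F) ∈ L₁ := fun x => by
    rw [hL₁N'', IntermediateField.mem_restrict]; exact hmemL₁' x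
  have hleN : L₂N ≤ L₁N' := fun x hx => (hmemL₁N' x).mpr
    ((IntermediateField.mem_restrictScalars (PadicBase F p hp)).mp (hL₂L₁ ((hmemL₂N x).mp hx)))
  set L₁N : IntermediateField L₂N N := extendScalars hleN with hL₁N'''
  have hmemL₁N : ∀ x : N, x ∈ L₁N ↔ (x : NormedAlgClosure F) ∈ L₁ := fun x => hmemL₁N' x
  obtain ⟨z, hztr, hzn⟩ := prop9_pushdown_of_tame hp hC N L₂N L₁N
  -- transport back to `L₂ ⊆ L₁`
  let e₄ : L₂N ≃+* L₂ :=
    { toFun := fun x => ⟨((x : N) : NormedAlgClosure F), (hmemL₂N _).mp x.2⟩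
      invFun := fun x => ⟨⟨(x : NormedAlgClosure F), hL₂N ((hmemL₂' _).mpr x.2)⟩,
        (hmemL₂N _).mpr x.2⟩
      left_inv := fun x => rfl
      right_inv := fun x => rfl
      map_mul' := fun x y => rfl
      map_add' := fun x y => rfl }
  let e₅ : L₁N ≃+* L₁ :=
    { toFun := fun x => ⟨((x : N) : NormedAlgClosure F), (hmemL₁N _).mp x.2⟩
      invFun := fun x => ⟨⟨(x : NormedAlgClosure F), hL₁N ((hmemL₁' _).mpr x.2)⟩,
        (hmemL₁N _).mpr x.2⟩
      left_inv := fun x => rfl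
      right_inv := fun x => rfl
      map_mul' := fun x y => rfl
      map_add' := fun x y => rfl }
  have hcomp₄₅ : (algebraMap L₂ L₁).comp e₄.toRingHom = e₅.toRingHom.comp (algebraMap L₂N L₁N) := by
    ext x; rfl
  refine ⟨e₅ z, ?_, hzn⟩
  have h := Algebra.trace_eq_of_equiv_equiv e₄ e₅ hcomp₄₅ z
  rw [hztr] at h
  rw [(RingEquiv.symm_apply_eq e₄).mp h.symm, map_one]

/-- **(TS1) for `F` from the tame package (C)** — the `F`-instance of the Tate–Sen axiom, BY NAME via
`TS1_of_almostEtale_fin`. [cite: Tate1967, §3.2 Prop. 9, Prop. 10] [cite: BergerColmez2008, Prop. 4.1.1] -/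
theorem TS1_of_tame
    (hC : ∀ (T : IntermediateField (TateTrace.Kinf hp) (NormedAlgClosure F)),
      FiniteDimensional (TateTrace.Kinf hp) T → ¬ p ∣ finrank (TateTrace.Kinf hp) T →
      ∃ s : ℝ, 0 < s ∧ (∀ x ∈ T, x ≠ 0 → ∃ c ∈ T, ‖c‖ ^ p = ‖x‖) ∧
        (∀ u ∈ T, ‖u‖ ≤ 1 → ∃ w ∈ T, ‖u - w ^ p‖ ≤ ‖(p : NormedAlgClosure F)‖ ^ s)) :
    ∃ K : ℝ, ∀ (H₁ H₂ : OpenSubgroup (BaseGaloisGroup.baseCyclotomicCharacter hp).ker), H₁ ≤ H₂ →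
      ∀ S : Finset (BaseGaloisGroup.baseCyclotomicCharacter hp).ker,
        (∀ s ∈ S, s ∈ H₂) → (∀ h ∈ H₂, ∃! s, s ∈ S ∧ s⁻¹ * h ∈ H₁) →
        ∃ α : CompletedAlgClosure F, (∀ u ∈ H₁, u • α = α) ∧ ‖α‖ ≤ K ∧ ∑ s ∈ S, s • α = 1 :=
  TS1_of_almostEtale_fin hp (fun L₂ hK hfin L₁ hfin₁ => h9_fin_of_tame hp hC L₂ hK hfin L₁ hfin₁)

/-- **The Tate–Sen axiom `tate1967_TS1_completedAlgClosure`, BY NAME, from the tame package (C) for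
every `p`-adic field**: the cite-only (TS1) is reduced to ONE elementary statement — finite extensions of
`K_∞` inside `F̄` of degree prime to `p` are almost-perfectoid ((Γ) and (U_s) for some `s > 0`).
[cite: Tate1967, §3.2 Prop. 9, Prop. 10] [cite: BergerColmez2008, Prop. 4.1.1] -/
theorem tate1967_TS1_of_tame
    (hC : ∀ {F : Type} [Field F] [ValuativeRel F] [TopologicalSpace F] [IsNonarchimedeanLocalField F]
      [CharZero F] {p : ℕ} [Fact p.Prime] (hp : valuation F p < 1)
      (T : IntermediateField (TateTrace.Kinf hp) (NormedAlgClosure F)),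
      FiniteDimensional (TateTrace.Kinf hp) T → ¬ p ∣ finrank (TateTrace.Kinf hp) T →
      ∃ s : ℝ, 0 < s ∧ (∀ x ∈ T, x ≠ 0 → ∃ c ∈ T, ‖c‖ ^ p = ‖x‖) ∧
        (∀ u ∈ T, ‖u‖ ≤ 1 → ∃ w ∈ T, ‖u - w ^ p‖ ≤ ‖(p : NormedAlgClosure F)‖ ^ s)) :
    tate1967_TS1_completedAlgClosure :=
  fun hp => TS1_of_tame hp (hC hp)

end TateAlmostEtale

end Literature.NumberTheory.PAdicHodge

end
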